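import Literature.AlgebraicGeometry.Resolution.AlterationsNormalProjectiveStepLeaves
import Literature.AlgebraicGeometry.Resolution.AlterationsNormalFormBlowupFormalProofs
import HarnessLib

/-!
# De Jong 1996, 4.13–4.28 (`DeJong1996NormalProjectiveStepVI`) from its seven open leaves

Topic: `Literature/AlgebraicGeometry/Resolution`. Bookkeeping (pure composition, no new named
fact) for the named fact `DeJong1996NormalProjectiveStepVI` of `AlterationsFibrations.lean` —
de Jong 1996, 4.13–4.28: over an algebraically closed field `k`, Thm. 4.1 with its
generically-étale clause in dimension `≤ d` (the induction hypothesis, consumed at 4.22) implies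
Thm. 4.1 with the clause for every pair `(X, Z)` of dimension `d + 1` in situation (vi)
(`DeJong1996.SituationVI`: (iii) projective, (iv) `Z` the support of a divisor, (v) normal, and a
fibration `f : X → Y` in curves over a projective variety with (vi) a)–d)).

Outcome of the split review (D-0026) of this fact, with the source open (pp. 69–76):

* The cut is the printed one. 4.12 ends "By replacing `(X, Z)` by `(X', Z')`, see 4.4 and 4.10,
  we may assume we have (i)–(v) and the following property: (vi) There exists a morphism
  `f : X → Y` of projective varieties such that: (vi) a) […] (vi) d)" (p. 69), and 4.13–4.28
  prove Thm. 4.1 for such pairs, using the induction hypothesis exactly once, at 4.22, for the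
  base `(Y, D)` with `dim Y = dim X - 1` (p. 74). The Lean statement renders this faithfully
  (`IsAlgClosed k` = (i); `NormalProjectivePair` = (iii)–(v); `IsCurveFibration`,
  `IsFiniteGenericallyEtaleOn` = (vi) a)–d) on scheme-theoretic fibres; `StatementUpToDim k d`
  with `dim X = d + 1` = the induction hypothesis; `ConclusionGenericallyEtale` = Thm. 4.1 with
  its last sentence). Nothing to restate, nothing to merge.
* As a whole it is a theory (the multisection Lemma 4.13, Galois normalisation 4.16, the
  level-`ℓ` moduli scheme of stable pointed curves 4.17/2.24, flattening and the three-point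
  Lemma 4.18–4.21, and §3 for 4.23–4.28), but its decomposition along the printed numbering is
  ALREADY in the tree with every piece of glue proved: the cut at 4.23
  (`DeJong1996NormalProjectiveStepVI.of_fibrationToSemiStablePair_of_resolution`,
  `AlterationsThreeBlocks.lean`), 4.13–4.22 from four leaves
  (`DeJong1996FibrationToSemiStablePair.of_printedLeaves`, `AlterationsStrongAlgClosedLeaves.lean`;
  4.14–4.15 and 4.22 proved) and 4.23–4.28 from three leaves
  (`DeJong1996SemiStablePairResolution.of_openLeaves`, `AlterationsNormalProjectiveStepLeaves.lean`,
  with the chart computation of Claim 4.27 since proved, `DeJong1996NodalBlowupSingularLocus_holds`).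
  So NO further split and NO new named fact is called for: the discharge
  `DeJong1996NormalProjectiveStepVI_holds` is literally the term below applied to the discharges
  of the seven named facts still open under it —
  `DeJong1996MultisectionHyperplane` (proof of Lemma 4.13, pp. 69–70; `AlterationsMultisectionLocalStep.lean`),
  `DeJong1996GaloisNormalization` (4.16, p. 71; `AlterationsStrictTransform.lean`),
  `DeJong1996StableExtension` (4.17 with 2.24, pp. 62, 71–72; `AlterationsStableModelParts.lean`),
  `DeJong1996RationalMapExtension` (4.18–4.21 with 2.19, pp. 72–74; `AlterationsRationalMapExtension.lean`),
  `DeJong1996NodeLocalStructure` (2.23/3.3 at closed points; `AlterationsNodeLocalStructure.lean`),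
  `DeJong1996NodeLocalStructureCodimTwo` (2.23/3.3 in codimension two; `AlterationsSemiStableNodeStructure.lean`),
  `DeJong1996SemiStableCodimTwoBlowupCore` (the Claim of 3.4, pp. 63–64; `AlterationsSemiStableNodeStructure.lean`) —
  each a distinct printed statement with its own locator and its own proving unit.

## Sources

* A. J. de Jong, *Smoothness, semi-stability and alterations*, Publ. Math. IHÉS 83 (1996) 51–93:
  4.12 (vi) (p. 69), Lemma 4.13–4.22 (pp. 69–75), 4.23–4.28 (pp. 75–76), 2.19, 2.23–2.24, 3.2–3.5.
-/

noncomputable section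

namespace Literature.AlgebraicGeometry.Resolution

universe u

open Literature.AlgebraicGeometry.Morphisms Literature.AlgebraicGeometry.FundamentalGroup

/-- **de Jong 1996, 4.13–4.28 (`DeJong1996NormalProjectiveStepVI`) from the seven named facts
currently open below it**: the hyperplane multisection of the proof of Lemma 4.13, the Galois
normalisation 4.16, the stable extension 4.17/2.24 and the extension of `β : 𝒞 ⇢ X` after a
modification of the base 4.18–4.21 give 4.13–4.22
(`DeJong1996FibrationToSemiStablePair.of_printedLeaves`); the node structure at closed points
and in codimension two (2.23/3.3) and the Claim of 3.4 give 4.23–4.28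
(`DeJong1996SemiStablePairResolution.of_openLeaves`, the singular locus of the blow-up of Claim
4.27 being proved, `DeJong1996NodalBlowupSingularLocus_holds`); the two blocks glue across the
printed cut at 4.23 (`DeJong1996NormalProjectiveStepVI.of_fibrationToSemiStablePair_of_resolution`).
Its discharge is this term fed with the seven discharges. [cite: DeJong1996, 4.13–4.28, pp. 69–76] -/
theorem DeJong1996NormalProjectiveStepVI.of_openLeaves₇
    -- 4.13–4.22
    (h13 : DeJong1996MultisectionHyperplane.{u}) (h16 : DeJong1996GaloisNormalization.{u})
    (h17 : DeJong1996StableExtension.{u}) (h18 : DeJong1996RationalMapExtension.{u})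
    -- 4.23–4.28
    (hN : DeJong1996NodeLocalStructure.{u}) (hN₂ : DeJong1996NodeLocalStructureCodimTwo.{u})
    (hK : DeJong1996SemiStableCodimTwoBlowupCore.{u}) :
    DeJong1996NormalProjectiveStepVI.{u} :=
  DeJong1996NormalProjectiveStepVI.of_fibrationToSemiStablePair_of_resolution
    (DeJong1996FibrationToSemiStablePair.of_printedLeaves h13 h16 h17 h18)
    (DeJong1996SemiStablePairResolution.of_openLeaves hN hN₂ hK
      DeJong1996NodalBlowupSingularLocus_holds)

/-- The same seven leaves together with the five open leaves of 4.11–4.12 give 4.11–4.28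
(`DeJong1996NormalProjectiveStep`) — a re-bracketing of
`DeJong1996NormalProjectiveStep.of_openLeaves₁₂` through the cut at 4.12
(`DeJong1996NormalProjectiveStep.of_fibration_of_stepVI`). [cite: DeJong1996, 4.11–4.28, pp. 67–76] -/
theorem DeJong1996NormalProjectiveStep.of_fibrationLeaves_of_stepVILeaves
    -- 4.11–4.12
    (hV : DeJong1996VertexBlowupProjection.{u}) (hC : DeJong1996Lemma411VertexChoice.{u})
    (hZ : steinFactorization_geometricallyConnected.{u}) (hE : DeJong1996SteinFactorizationEtale.{u})
    (hP1 : ProjectiveLineSimplyConnected.{u})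
    (hH : EtaleCoverHyperplaneSectionConnected.{u})
    -- 4.13–4.28
    (h13 : DeJong1996MultisectionHyperplane.{u}) (h16 : DeJong1996GaloisNormalization.{u})
    (h17 : DeJong1996StableExtension.{u}) (h18 : DeJong1996RationalMapExtension.{u})
    (hN : DeJong1996NodeLocalStructure.{u}) (hN₂ : DeJong1996NodeLocalStructureCodimTwo.{u})
    (hK : DeJong1996SemiStableCodimTwoBlowupCore.{u}) :
    DeJong1996NormalProjectiveStep.{u} :=
  DeJong1996NormalProjectiveStep.of_fibration_of_stepVI
    (DeJong1996FibrationReduction.of_openLeaves hV hC hZ hE hP1 hH)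
    (DeJong1996NormalProjectiveStepVI.of_openLeaves₇ h13 h16 h17 h18 hN hN₂ hK)

end Literature.AlgebraicGeometry.Resolution

end
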